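import Mathlib

/-!
# SoloBlind artefact 10 — leakage of a trigonometric polynomial onto an arc (Turán–Nazarov type)

Soloist `solo-RiemannHypothesis-blind`, session 12 (paper/window-height.md §9.2, Lemma G♭; claims C41).

For a complex polynomial `p` of degree `≤ n` — i.e. an index-limited sequence of `N = n + 1`
coefficients, `p (e^{iθ}) = ∑_{k ≤ n} c_k e^{ikθ}` — and an arc `{e^{iθ} : φ₀ ≤ θ ≤ φ₀ + L}` of
angular length `0 < L ≤ 2π`:

* `soloBlind_arc_sup_bound` : for `‖z‖ ≤ 1`,
  `(L/2) ‖p z‖² ≤ Λ² (n+1)² ∫_{φ₀}^{φ₀+L} ‖p(e^{iθ})‖² dθ`, `Λ = (π / (L/(2n)))^n = (2πn/L)^n`;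
* `soloBlind_arc_leakage` :
  `(L / (4π (n+1)² Λ²)) ∫_0^{2π} ‖p(e^{iθ})‖² dθ ≤ ∫_{φ₀}^{φ₀+L} ‖p(e^{iθ})‖² dθ`;
* `soloBlind_dpss_leakage_floor` : with `φ₀ = 2πW`, `L = 2π(1 − 2W)`, `0 < W < 1/2`, `N ≥ 1`:
  `((1−2W)/(2N²)) ((1−2W)/(N−1))^{2(N−1)} ∫_0^{2π} ‖p‖² ≤ ∫_{2πW}^{2π(1−W)} ‖p‖²`
  for every `p` of degree `< N` — in the language of Slepian's discrete prolate spheroidal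
  sequences: `1 − λ₀(N, W) ≥ ((1−2W)/(2N²))·((1−2W)/(N−1))^{2(N−1)}`, an explicit (crude) floor for
  the spectral leakage of the best-concentrated index-limited sequence.

Proof: Lagrange interpolation at `n + 1` equispaced nodes on HALF of the arc (chord ≥ (2/π)·arc gives
`|ℓ_k| ≤ (π/h)^n` on the circle, `h = L/(2n)`), Cauchy–Schwarz, and an average over the rotations of
the node set inside the arc; then integration over the circle.

What this is NOT. Not new in substance: it is the consecutive-frequency case of Turán's lemma /
Nazarov's inequality (F. Nazarov, Algebra i Analiz 5 (1993); see also O. Friedland, Y. Yomdin,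
"An observation on the Turán–Nazarov inequality", Thm 1.1) with a crude explicit constant (the
sharper `((1−2W)/(2e))^{2(N−1)}` of Lemma G in the report needs `k!(n−k)! ≥ n!/2ⁿ` and Stirling and
is not formalised here). Not a statement about the Riemann zeta function: it is the finite-dimensional
ingredient of the report's Theorem D6 (a limit on what window-limited Weil positivity can detect),
recorded so that D6's one quantitative input is kernel-checked. Any floor `exp(−O(N log N))` serves D6.
-/

open Complex Polynomial Real MeasureTheory intervalIntegral Finset

namespace Summit.RiemannHypothesis.RiemannHypothesis.Theorems

/-! ### 1. Chords of the unit circle -/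

/-- Chord length on the unit circle: `‖e^{iα} − e^{iβ}‖ = |2 sin((α−β)/2)|`. -/
theorem soloBlind_chord_norm (α β : ℝ) :
    ‖cexp (I * α) - cexp (I * β)‖ = |2 * Real.sin ((α - β) / 2)| := by
  have h : cexp (I * α) - cexp (I * β) = cexp (I * β) * (cexp (I * ((α - β : ℝ) : ℂ)) - 1) := by
    rw [mul_sub, mul_one, ← Complex.exp_add]
    congr 1
    congr 1
    push_cast
    ring
  rw [h, norm_mul, Complex.norm_exp_I_mul_ofReal, one_mul, Complex.norm_exp_I_mul_ofReal_sub_one,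
    Real.norm_eq_abs]

/-- `|sin y| = sin |y|` for `|y| ≤ π`. -/
theorem soloBlind_abs_sin_eq (y : ℝ) (hy : |y| ≤ π) : |Real.sin y| = Real.sin |y| := by
  rcases le_or_gt 0 y with h | h
  · rw [abs_of_nonneg h] at hy ⊢
    exact abs_of_nonneg (Real.sin_nonneg_of_nonneg_of_le_pi h hy)
  · rw [abs_of_neg h] at hy ⊢
    rw [Real.sin_neg]
    have h1 : 0 ≤ Real.sin (-y) := Real.sin_nonneg_of_nonneg_of_le_pi (by linarith) hy
    rw [Real.sin_neg] at h1
    exact abs_of_nonpos (by linarith)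

/-- chord ≥ (2/π)·arc for arcs of length ≤ π (Jordan's inequality). -/
theorem soloBlind_chord_lower (α β : ℝ) (h : |α - β| ≤ π) :
    2 / π * |α - β| ≤ ‖cexp (I * α) - cexp (I * β)‖ := by
  rw [soloBlind_chord_norm]
  have h1 : |(α - β) / 2| ≤ π := by
    rw [abs_div, abs_two]; linarith [abs_nonneg (α - β), Real.pi_pos]
  rw [abs_mul, abs_two, soloBlind_abs_sin_eq _ h1, abs_div, abs_two]
  have h2 : 0 ≤ |α - β| / 2 := by positivity
  have h3 : |α - β| / 2 ≤ π / 2 := by linarith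
  have h4 := Real.mul_le_sin h2 h3
  calc 2 / π * |α - β| = 2 * (2 / π * (|α - β| / 2)) := by ring
    _ ≤ 2 * Real.sin (|α - β| / 2) := by linarith

/-! ### 2. Lagrange basis at equispaced nodes on an arc -/

/-- `‖(basisDivisor x y)(z)‖ = ‖z − y‖ / ‖x − y‖`. -/
theorem soloBlind_norm_eval_basisDivisor (x y z : ℂ) :
    ‖eval z (Lagrange.basisDivisor x y)‖ = ‖z - y‖ / ‖x - y‖ := by
  simp only [Lagrange.basisDivisor, eval_mul, eval_C, eval_sub, eval_X, norm_mul, norm_inv]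
  rw [div_eq_inv_mul]

/-- Chord between two of the nodes `e^{i(φ + jh)}`, `j ≤ n`, when `n h ≤ π`. -/
theorem soloBlind_node_chord (φ h : ℝ) (hh : 0 ≤ h) (n : ℕ) (hn : (n : ℝ) * h ≤ π)
    (v : ℕ → ℂ) (hv : ∀ j, v j = cexp (I * ((φ + j * h : ℝ) : ℂ)))
    (j k : ℕ) (hj : j ≤ n) (hk : k ≤ n) :
    2 / π * (|(k : ℝ) - j| * h) ≤ ‖v k - v j‖ := by
  have habs : |(φ + k * h) - (φ + j * h)| = |(k : ℝ) - j| * h := by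
    rw [show (φ + k * h) - (φ + j * h) = ((k : ℝ) - j) * h by ring, abs_mul, abs_of_nonneg hh]
  have hkj : |(k : ℝ) - j| ≤ n := by
    have hk' : (k : ℝ) ≤ n := by exact_mod_cast hk
    have hj' : (j : ℝ) ≤ n := by exact_mod_cast hj
    rw [abs_sub_le_iff]
    constructor <;> linarith [Nat.cast_nonneg (α := ℝ) j, Nat.cast_nonneg (α := ℝ) k]
  have hle : |(φ + k * h) - (φ + j * h)| ≤ π := by
    rw [habs]
    calc |(k : ℝ) - j| * h ≤ n * h := mul_le_mul_of_nonneg_right hkj hh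
      _ ≤ π := hn
  have h1 := soloBlind_chord_lower (φ + k * h) (φ + j * h) hle
  rw [habs] at h1
  rw [hv k, hv j]
  exact h1

/-- `|ℓ_k(z)| ≤ (π/h)^n` on the closed unit disc for the Lagrange basis at the nodes
`e^{i(φ + jh)}`, `j = 0..n`, provided `n h ≤ π` (and `h > 0` as soon as there are two nodes). -/
theorem soloBlind_basis_bound (φ h : ℝ) (hh : 0 ≤ h) (n : ℕ) (hn : (n : ℝ) * h ≤ π)
    (hpos : 1 ≤ n → 0 < h)
    (v : ℕ → ℂ) (hv : ∀ j, v j = cexp (I * ((φ + j * h : ℝ) : ℂ)))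
    (k : ℕ) (hk : k ∈ range (n + 1)) (z : ℂ) (hz : ‖z‖ ≤ 1) :
    ‖eval z (Lagrange.basis (range (n + 1)) v k)‖ ≤ (π / h) ^ n := by
  rw [Lagrange.basis, eval_prod, norm_prod]
  have hcard : ((range (n + 1)).erase k).card = n := by
    rw [card_erase_of_mem hk, card_range]; simp
  have hkn : k ≤ n := by rw [mem_range] at hk; omega
  calc ∏ j ∈ (range (n + 1)).erase k, ‖eval z (Lagrange.basisDivisor (v k) (v j))‖
      ≤ ∏ _j ∈ (range (n + 1)).erase k, (π / h) := by
        apply Finset.prod_le_prod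
        · intro i _; exact norm_nonneg _
        · intro j hj
          rw [mem_erase, mem_range] at hj
          obtain ⟨hjk, hjn⟩ := hj
          have hjn' : j ≤ n := by omega
          have hn1 : 1 ≤ n := by omega
          have hh' : 0 < h := hpos hn1
          rw [soloBlind_norm_eval_basisDivisor]
          have hnum : ‖z - v j‖ ≤ 2 := by
            calc ‖z - v j‖ ≤ ‖z‖ + ‖v j‖ := norm_sub_le _ _
              _ ≤ 1 + 1 := by rw [hv j, Complex.norm_exp_I_mul_ofReal]; linarith
              _ = 2 := by norm_num
          have hone : (1 : ℝ) ≤ |(k : ℝ) - j| := by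
            rcases lt_or_gt_of_ne hjk with hlt | hgt
            · have : (j : ℝ) + 1 ≤ k := by exact_mod_cast hlt
              rw [le_abs]; left; linarith
            · have : (k : ℝ) + 1 ≤ j := by exact_mod_cast hgt
              rw [le_abs]; right; linarith
          have hden : 2 / π * h ≤ ‖v k - v j‖ := by
            have h1 := soloBlind_node_chord φ h hh n hn v hv j k hjn' hkn
            have h2 : 2 / π * h ≤ 2 / π * (|(k : ℝ) - j| * h) := by
              apply mul_le_mul_of_nonneg_left _ (by positivity)
              nlinarith
            exact h2.trans h1
          have hden_pos : 0 < 2 / π * h := by positivity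
          calc ‖z - v j‖ / ‖v k - v j‖ ≤ 2 / (2 / π * h) := div_le_div₀ (by norm_num) hnum hden_pos hden
            _ = π / h := by field_simp
    _ = (π / h) ^ n := by rw [prod_const, hcard]

/-- Interpolation bound: `‖p z‖ ≤ (π/h)^n ∑_k ‖p(v_k)‖` for `‖z‖ ≤ 1`, `deg p ≤ n`. -/
theorem soloBlind_interp_bound (φ h : ℝ) (hh : 0 ≤ h) (n : ℕ) (hn : (n : ℝ) * h ≤ π)
    (hpos : 1 ≤ n → 0 < h)
    (v : ℕ → ℂ) (hv : ∀ j, v j = cexp (I * ((φ + j * h : ℝ) : ℂ)))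
    (p : ℂ[X]) (hp : p.degree < ((n + 1 : ℕ) : WithBot ℕ)) (z : ℂ) (hz : ‖z‖ ≤ 1) :
    ‖p.eval z‖ ≤ (π / h) ^ n * ∑ k ∈ range (n + 1), ‖p.eval (v k)‖ := by
  have hinj : Set.InjOn v (range (n + 1)) := by
    intro j hj k hk hjk
    by_contra hne
    simp only [coe_range, Set.mem_Iio] at hj hk
    have h1 := soloBlind_node_chord φ h hh n hn v hv j k (by omega) (by omega)
    rw [hjk, sub_self, norm_zero] at h1
    have hn1 : 1 ≤ n := by omega
    have hkj : 0 < |(k : ℝ) - j| := by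
      rw [abs_pos, sub_ne_zero]
      exact_mod_cast (Ne.symm hne)
    have : 0 < 2 / π * (|(k : ℝ) - j| * h) := by
      have := hpos hn1
      positivity
    linarith
  have hdeg : p.degree < ((range (n + 1)).card : WithBot ℕ) := by rw [card_range]; exact hp
  have heq := Lagrange.eq_interpolate hinj hdeg
  calc ‖p.eval z‖
      = ‖eval z (Lagrange.interpolate (range (n + 1)) v fun i => p.eval (v i))‖ := by rw [← heq]
    _ = ‖∑ k ∈ range (n + 1), p.eval (v k) * eval z (Lagrange.basis (range (n + 1)) v k)‖ := by
        rw [Lagrange.interpolate_apply, eval_finsetSum]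
        simp only [eval_mul, eval_C]
    _ ≤ ∑ k ∈ range (n + 1), ‖p.eval (v k) * eval z (Lagrange.basis (range (n + 1)) v k)‖ :=
        norm_sum_le _ _
    _ ≤ ∑ k ∈ range (n + 1), ‖p.eval (v k)‖ * (π / h) ^ n := by
        apply sum_le_sum
        intro k hk
        rw [norm_mul]
        exact mul_le_mul_of_nonneg_left (soloBlind_basis_bound φ h hh n hn hpos v hv k hk z hz)
          (norm_nonneg _)
    _ = (π / h) ^ n * ∑ k ∈ range (n + 1), ‖p.eval (v k)‖ := by rw [← sum_mul, mul_comm]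

/-- Squared form with Cauchy–Schwarz: `‖p z‖² ≤ Λ² (n+1) ∑_k ‖p(v_k)‖²`. -/
theorem soloBlind_interp_sq_bound (φ h : ℝ) (hh : 0 ≤ h) (n : ℕ) (hn : (n : ℝ) * h ≤ π)
    (hpos : 1 ≤ n → 0 < h)
    (v : ℕ → ℂ) (hv : ∀ j, v j = cexp (I * ((φ + j * h : ℝ) : ℂ)))
    (p : ℂ[X]) (hp : p.degree < ((n + 1 : ℕ) : WithBot ℕ)) (z : ℂ) (hz : ‖z‖ ≤ 1) :
    ‖p.eval z‖ ^ 2 ≤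
      ((π / h) ^ n) ^ 2 * (((n : ℝ) + 1) * ∑ k ∈ range (n + 1), ‖p.eval (v k)‖ ^ 2) := by
  have h1 := soloBlind_interp_bound φ h hh n hn hpos v hv p hp z hz
  have hΛ : 0 ≤ (π / h) ^ n := pow_nonneg (div_nonneg Real.pi_pos.le hh) n
  have hS : 0 ≤ ∑ k ∈ range (n + 1), ‖p.eval (v k)‖ := sum_nonneg fun k _ => norm_nonneg _
  have h2 : ‖p.eval z‖ ^ 2 ≤ ((π / h) ^ n * ∑ k ∈ range (n + 1), ‖p.eval (v k)‖) ^ 2 :=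
    pow_le_pow_left₀ (norm_nonneg _) h1 2
  have h3 : (∑ k ∈ range (n + 1), ‖p.eval (v k)‖) ^ 2
      ≤ ((range (n + 1)).card : ℝ) * ∑ k ∈ range (n + 1), ‖p.eval (v k)‖ ^ 2 :=
    sq_sum_le_card_mul_sum_sq
  rw [card_range] at h3
  push_cast at h3
  calc ‖p.eval z‖ ^ 2 ≤ ((π / h) ^ n * ∑ k ∈ range (n + 1), ‖p.eval (v k)‖) ^ 2 := h2
    _ = ((π / h) ^ n) ^ 2 * (∑ k ∈ range (n + 1), ‖p.eval (v k)‖) ^ 2 := by ring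
    _ ≤ ((π / h) ^ n) ^ 2 * (((n : ℝ) + 1) * ∑ k ∈ range (n + 1), ‖p.eval (v k)‖ ^ 2) :=
        mul_le_mul_of_nonneg_left h3 (pow_nonneg hΛ 2)

/-! ### 3. The rotation average (abstract constant), the circle integral, and the instances -/

/-- **Rotation average.** If `‖p z‖² ≤ Λ² (n+1) ∑_{k ≤ n} ‖p(e^{i(φ₀ + t + kh)})‖²` for every shift
`t`, `h = L/(2n)`, then `(L/2) ‖p z‖² ≤ Λ² (n+1)² ∫_{φ₀}^{φ₀+L} ‖p(e^{iθ})‖² dθ`. -/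
theorem soloBlind_arc_sup_of_interp (p : ℂ[X]) (n : ℕ) (φ₀ L : ℝ) (hL : 0 < L)
    (Λ : ℝ) (z : ℂ)
    (hinterp : ∀ t : ℝ, ‖p.eval z‖ ^ 2 ≤ Λ ^ 2 * (((n : ℝ) + 1) *
      ∑ k ∈ range (n + 1), ‖p.eval (cexp (I * ((φ₀ + t + k * (L / (2 * n)) : ℝ) : ℂ)))‖ ^ 2)) :
    L / 2 * ‖p.eval z‖ ^ 2 ≤ Λ ^ 2 * ((n : ℝ) + 1) ^ 2 *
        ∫ θ in φ₀..(φ₀ + L), ‖p.eval (cexp (I * θ))‖ ^ 2 := by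
  set h := L / (2 * n) with hh_def
  set f : ℝ → ℝ := fun θ => ‖p.eval (cexp (I * θ))‖ ^ 2 with hf_def
  have hh : 0 ≤ h := by positivity
  have hnh : (n : ℝ) * h ≤ L / 2 := by
    rcases Nat.eq_zero_or_pos n with hn0 | hnpos
    · simp [hn0]; linarith
    · have hn' : (n : ℝ) ≠ 0 := by positivity
      have : (n : ℝ) * (L / (2 * n)) = L / 2 := by field_simp
      rw [hh_def, this]
  have hf_cont : Continuous f := by
    have hc : Continuous fun θ : ℝ => p.eval (cexp (I * θ)) :=
      p.continuous.comp (Complex.continuous_exp.comp (continuous_const.mul Complex.continuous_ofReal))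
    exact (hc.norm).pow 2
  have hf_nn : ∀ θ, 0 ≤ f θ := fun θ => by positivity
  have stepA : ∀ t : ℝ, ‖p.eval z‖ ^ 2 ≤
      Λ ^ 2 * (((n : ℝ) + 1) * ∑ k ∈ range (n + 1), f (φ₀ + t + k * h)) := hinterp
  -- Step B: average Step A over t ∈ [0, L/2]
  have hgi : ∀ k : ℕ, Continuous fun t : ℝ => f (φ₀ + t + k * h) := fun k =>
    hf_cont.comp ((continuous_const.add continuous_id).add continuous_const)
  have hG_cont : Continuous fun t : ℝ =>
      Λ ^ 2 * (((n : ℝ) + 1) * ∑ k ∈ range (n + 1), f (φ₀ + t + k * h)) :=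
    continuous_const.mul (continuous_const.mul (continuous_finsetSum _ fun k _ => hgi k))
  have stepB : L / 2 * ‖p.eval z‖ ^ 2 ≤ Λ ^ 2 *
      (((n : ℝ) + 1) * ∑ k ∈ range (n + 1), ∫ t in (0 : ℝ)..(L / 2), f (φ₀ + t + k * h)) := by
    have hint : ∫ t in (0 : ℝ)..(L / 2),
        Λ ^ 2 * (((n : ℝ) + 1) * ∑ k ∈ range (n + 1), f (φ₀ + t + k * h))
        = Λ ^ 2 *
          (((n : ℝ) + 1) * ∑ k ∈ range (n + 1), ∫ t in (0 : ℝ)..(L / 2), f (φ₀ + t + k * h)) := by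
      rw [intervalIntegral.integral_const_mul, intervalIntegral.integral_const_mul,
        intervalIntegral.integral_finsetSum]
      intro k _
      exact (hgi k).intervalIntegrable _ _
    have hconst : ∫ _ in (0 : ℝ)..(L / 2), ‖p.eval z‖ ^ 2 = L / 2 * ‖p.eval z‖ ^ 2 := by
      rw [intervalIntegral.integral_const, smul_eq_mul]; ring
    rw [← hconst, ← hint]
    exact intervalIntegral.integral_mono_on (by positivity) intervalIntegrable_const
      (hG_cont.intervalIntegrable _ _) (fun t _ => stepA t)
  -- Step B2: each rotated node runs over a sub-arc of the arc
  have stepB2 : ∀ k ∈ range (n + 1),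
      ∫ t in (0 : ℝ)..(L / 2), f (φ₀ + t + k * h) ≤ ∫ θ in φ₀..(φ₀ + L), f θ := by
    intro k hk
    have hk' : (k : ℝ) * h ≤ L / 2 := by
      have : (k : ℝ) ≤ n := by exact_mod_cast Nat.lt_succ_iff.mp (mem_range.mp hk)
      calc (k : ℝ) * h ≤ n * h := mul_le_mul_of_nonneg_right this hh
        _ ≤ L / 2 := hnh
    have hkh : 0 ≤ (k : ℝ) * h := mul_nonneg (Nat.cast_nonneg k) hh
    have h1 : ∫ t in (0 : ℝ)..(L / 2), f (φ₀ + t + k * h)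
        = ∫ θ in (φ₀ + k * h)..(φ₀ + k * h + L / 2), f θ := by
      have h2 := intervalIntegral.integral_comp_add_right (a := 0) (b := L / 2) f (φ₀ + k * h)
      rw [zero_add, show L / 2 + (φ₀ + k * h) = φ₀ + k * h + L / 2 by ring] at h2
      rw [← h2]
      have hfun : (fun t => f (φ₀ + t + k * h)) = fun t => f (t + (φ₀ + k * h)) := by
        funext t; rw [show φ₀ + t + k * h = t + (φ₀ + k * h) by ring]
      rw [hfun]
    rw [h1]
    apply intervalIntegral.integral_mono_interval (by linarith) (by linarith) (by linarith)
    · exact Filter.Eventually.of_forall fun θ => hf_nn θ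
    · exact hf_cont.intervalIntegrable _ _
  have hΛ2 : 0 ≤ Λ ^ 2 := by positivity
  calc L / 2 * ‖p.eval z‖ ^ 2
      ≤ Λ ^ 2 * (((n : ℝ) + 1) *
          ∑ k ∈ range (n + 1), ∫ t in (0 : ℝ)..(L / 2), f (φ₀ + t + k * h)) := stepB
    _ ≤ Λ ^ 2 * (((n : ℝ) + 1) * ∑ k ∈ range (n + 1), ∫ θ in φ₀..(φ₀ + L), f θ) := by
        gcongr with k hk
        exact stepB2 k hk
    _ = Λ ^ 2 * ((n : ℝ) + 1) ^ 2 * ∫ θ in φ₀..(φ₀ + L), f θ := by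
        rw [sum_const, card_range]; simp; ring

/-- **From a sup bound on the circle to the leakage inequality.** If
`(L/2) ‖p(e^{iθ})‖² ≤ C ∫_{φ₀}^{φ₀+L} ‖p‖²` for all `θ`, then
`(L/(4πC)) ∫_0^{2π} ‖p(e^{iθ})‖² ≤ ∫_{φ₀}^{φ₀+L} ‖p(e^{iθ})‖²`. -/
theorem soloBlind_arc_leakage_of_sup (p : ℂ[X]) (φ₀ L C : ℝ) (hL : 0 < L) (hC : 0 < C)
    (hsup : ∀ θ : ℝ, L / 2 * ‖p.eval (cexp (I * θ))‖ ^ 2 ≤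
      C * ∫ θ in φ₀..(φ₀ + L), ‖p.eval (cexp (I * θ))‖ ^ 2) :
    L / (4 * π * C) * ∫ θ in (0 : ℝ)..(2 * π), ‖p.eval (cexp (I * θ))‖ ^ 2
      ≤ ∫ θ in φ₀..(φ₀ + L), ‖p.eval (cexp (I * θ))‖ ^ 2 := by
  set A := ∫ θ in φ₀..(φ₀ + L), ‖p.eval (cexp (I * θ))‖ ^ 2 with hA
  have hcont : Continuous fun θ : ℝ => ‖p.eval (cexp (I * θ))‖ ^ 2 := by
    have hc : Continuous fun θ : ℝ => p.eval (cexp (I * θ)) :=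
      p.continuous.comp (Complex.continuous_exp.comp (continuous_const.mul Complex.continuous_ofReal))
    exact (hc.norm).pow 2
  have hL2 : (0 : ℝ) < L / 2 := by positivity
  have hint : ∫ θ in (0 : ℝ)..(2 * π), ‖p.eval (cexp (I * θ))‖ ^ 2
      ≤ ∫ _ in (0 : ℝ)..(2 * π), 2 / L * (C * A) := by
    apply intervalIntegral.integral_mono_on (by positivity) (hcont.intervalIntegrable _ _)
      intervalIntegrable_const
    intro θ _
    have h1 := hsup θ
    have h2 : ‖p.eval (cexp (I * θ))‖ ^ 2 ≤ C * A / (L / 2) := by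
      rw [le_div_iff₀ hL2]; linarith
    calc ‖p.eval (cexp (I * θ))‖ ^ 2 ≤ C * A / (L / 2) := h2
      _ = 2 / L * (C * A) := by field_simp
  rw [intervalIntegral.integral_const, smul_eq_mul] at hint
  have hden : 0 < 4 * π * C := by positivity
  rw [div_mul_eq_mul_div, div_le_iff₀ hden]
  have h3 := mul_le_mul_of_nonneg_left hint hL.le
  calc L * ∫ θ in (0 : ℝ)..(2 * π), ‖p.eval (cexp (I * θ))‖ ^ 2
      ≤ L * ((2 * π - 0) * (2 / L * (C * A))) := h3
    _ = A * (4 * π * C) := by field_simp; ring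

/-- **Sup bound** with the crude constant: for `deg p ≤ n`, `0 < L ≤ 2π`, `‖z‖ ≤ 1`,
`(L/2) ‖p z‖² ≤ ((π/(L/(2n)))^n)² (n+1)² ∫_{φ₀}^{φ₀+L} ‖p(e^{iθ})‖² dθ`. -/
theorem soloBlind_arc_sup_bound (p : ℂ[X]) (n : ℕ) (hp : p.degree < ((n + 1 : ℕ) : WithBot ℕ))
    (φ₀ L : ℝ) (hL : 0 < L) (hL' : L ≤ 2 * π) (z : ℂ) (hz : ‖z‖ ≤ 1) :
    L / 2 * ‖p.eval z‖ ^ 2 ≤ ((π / (L / (2 * n))) ^ n) ^ 2 * ((n : ℝ) + 1) ^ 2 *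
        ∫ θ in φ₀..(φ₀ + L), ‖p.eval (cexp (I * θ))‖ ^ 2 := by
  have hh : 0 ≤ L / (2 * n) := by positivity
  have hnπ : (n : ℝ) * (L / (2 * n)) ≤ π := by
    rcases Nat.eq_zero_or_pos n with hn0 | hnpos
    · simp [hn0]; positivity
    · have hn' : (n : ℝ) ≠ 0 := by positivity
      have : (n : ℝ) * (L / (2 * n)) = L / 2 := by field_simp
      rw [this]; linarith
  have hpos : 1 ≤ n → 0 < L / (2 * n) := by
    intro hn1
    have : (0 : ℝ) < n := by exact_mod_cast hn1
    positivity
  refine soloBlind_arc_sup_of_interp p n φ₀ L hL _ z fun t => ?_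
  exact soloBlind_interp_sq_bound (φ₀ + t) (L / (2 * n)) hh n hnπ hpos
    (fun j => cexp (I * ((φ₀ + t + j * (L / (2 * n)) : ℝ) : ℂ))) (fun j => rfl) p hp z hz

/-- **Leakage inequality (Lemma G♭ of the report).** For `deg p ≤ n` and an arc of angular length
`0 < L ≤ 2π` starting at `φ₀`, with `Λ = (π/(L/(2n)))^n = (2πn/L)^n`:
`(L / (4π (Λ² (n+1)²))) ∫_0^{2π} ‖p(e^{iθ})‖² dθ ≤ ∫_{φ₀}^{φ₀+L} ‖p(e^{iθ})‖² dθ`. -/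
theorem soloBlind_arc_leakage (p : ℂ[X]) (n : ℕ) (hp : p.degree < ((n + 1 : ℕ) : WithBot ℕ))
    (φ₀ L : ℝ) (hL : 0 < L) (hL' : L ≤ 2 * π) :
    L / (4 * π * (((π / (L / (2 * n))) ^ n) ^ 2 * ((n : ℝ) + 1) ^ 2)) *
        ∫ θ in (0 : ℝ)..(2 * π), ‖p.eval (cexp (I * θ))‖ ^ 2
      ≤ ∫ θ in φ₀..(φ₀ + L), ‖p.eval (cexp (I * θ))‖ ^ 2 := by
  have hΛpos : 0 < (π / (L / (2 * n))) ^ n := by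
    rcases Nat.eq_zero_or_pos n with h0 | hnpos
    · simp [h0]
    · have : (0 : ℝ) < n := by exact_mod_cast hnpos
      positivity
  exact soloBlind_arc_leakage_of_sup p φ₀ L _ hL (by positivity)
    fun θ => soloBlind_arc_sup_bound p n hp φ₀ L hL hL' _ (by rw [Complex.norm_exp_I_mul_ofReal])

/-- **Lemma G♭ (DPSS leakage floor).** For `N ≥ 1`, `0 < W < 1/2` and every complex polynomial `p`
of degree `< N` (an index-limited sequence of length `N`):
`((1−2W)/(2N²))·((1−2W)/(N−1))^{2(N−1)} · ∫_0^{2π} ‖p(e^{iθ})‖² ≤ ∫_{2πW}^{2π(1−W)} ‖p(e^{iθ})‖²`,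
i.e. `1 − λ₀(N, W) ≥ ((1−2W)/(2N²))((1−2W)/(N−1))^{2(N−1)}` for Slepian's prolate matrix
(for `N = 1` read `(·)^0 = 1`). -/
theorem soloBlind_dpss_leakage_floor (N : ℕ) (hN : 1 ≤ N) (W : ℝ) (hW0 : 0 < W) (hW : W < 1 / 2)
    (p : ℂ[X]) (hp : p.degree < (N : WithBot ℕ)) :
    (1 - 2 * W) / (2 * (N : ℝ) ^ 2) * ((1 - 2 * W) / ((N : ℝ) - 1)) ^ (2 * (N - 1)) *
        ∫ θ in (0 : ℝ)..(2 * π), ‖p.eval (cexp (I * θ))‖ ^ 2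
      ≤ ∫ θ in (2 * π * W)..(2 * π * (1 - W)), ‖p.eval (cexp (I * θ))‖ ^ 2 := by
  obtain ⟨n, rfl⟩ : ∃ n, N = n + 1 := ⟨N - 1, by omega⟩
  have hw : 0 < 1 - 2 * W := by linarith
  have hL : 0 < 2 * π * (1 - 2 * W) := by positivity
  have hL' : 2 * π * (1 - 2 * W) ≤ 2 * π := by nlinarith [Real.pi_pos]
  have key := soloBlind_arc_leakage p n hp (2 * π * W) (2 * π * (1 - 2 * W)) hL hL'
  rw [show 2 * π * W + 2 * π * (1 - 2 * W) = 2 * π * (1 - W) by ring] at key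
  refine le_trans (le_of_eq ?_) key
  congr 1
  have hπ : (π : ℝ) ≠ 0 := Real.pi_pos.ne'
  have hw' : (1 - 2 * W) ≠ 0 := hw.ne'
  simp only [Nat.cast_add, Nat.cast_one, Nat.add_sub_cancel]
  rcases Nat.eq_zero_or_pos n with h0 | hnpos
  · subst h0
    simp
    field_simp
    ring
  · have hn' : (n : ℝ) ≠ 0 := by positivity
    have hq : π / (2 * π * (1 - 2 * W) / (2 * (n : ℝ))) = n / (1 - 2 * W) := by
      field_simp
    rw [hq, show ((n : ℝ) + 1 - 1) = n by ring, ← pow_mul, show n * 2 = 2 * n by ring,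
      div_pow, div_pow]
    field_simp
    ring

end Summit.RiemannHypothesis.RiemannHypothesis.Theorems
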